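import Summits.QuantumFields.BalabanUV.Beta.GAN24.ExitFaceSlotStaircase

/-!
# `BalabanUV.Beta.GAN24.StaircaseCurrentAntisymm` — binder row G-an2-4 ∕ (CONV-C), W-slot (α-0), ROW (C) AT LEVELS `j ≥ 1`: **THE STAIRCASE CURRENTS OF THE E-SECTOR EE WORD ARE
# ANTISYMMETRIC UNDER THE EXCHANGE OF THE BACKGROUND DIRECTION AND THE LEG DIRECTION —
# `Σ'_{s′} E2_{j+1}(z,s′)_{bβ}·⌊s′_ν∕Lc⌋χ_β(s′) = −Σ'_{s′} E2_{j+1}(z,s′)_{bν}·⌊s′_β∕Lc⌋χ_ν(s′)` (`ν ≠ β`), `Σ'_{s′} E2_{j+1}(z,s′)_{bν}·⌊s′_ν∕Lc⌋χ_ν(s′) = 0`** (and the first-leg twins) —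
# because the value Hessian kills the gradient of the QUADRATIC-GROWTH potential `⌊·_ν∕Lc⌋·⌊·_β∕Lc⌋`, whose lattice gradient is exactly «staircase_ν × face_β + face_ν × staircase_β»
# (every `j`, every `d`, `Lc ≥ 1`) (G-an2-4 CRUX TEAM (2), seat `b2b-balaban-gan24-formalise-leaf-06` = the (γ) hand, gen 53; journal INTENT I-leaf06-g53-3)

NOT IN PRINT; OUR BOOKKEEPING ([folklore] BY NAME: D1 `ValueHessianLinearGauge` §1–§3 (`le_two_div_mul_exp`, `tsum_wΦ_mul_grad_eq_zero_of_summable ∕ tsum_grad_mul_wΦ_eq_zero_of_summable`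
— the summation by parts with the summability sockets left open — `staircase_grad`, `abs_staircase_le`, `tsum_E2_mul_exitFace_eq_zero′ ∕ tsum_exitFace_mul_E2_eq_zero′`), an5's
`KernelSpecInstance.decay_wΦ`, `BorderedHessian.E2_inl_inl_eq_wΦ`, (W3) `ExitFaceHalfVertexSplit.summable_E2_mul_linGrowth_face ∕ summable_linGrowth_face_mul_E2`; 0 `def`, 0 cited fact,
0 `def … : Prop`, 0 sorry).
HONEST FRAMING (cell contract, verbatim): «discharging `BetaPertH` makes Bałaban's UV stability UNCONDITIONAL — a real constructive-QFT result; it is NOT the continuum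
limit and NOT the Clay problem.»  HONEST DEPENDENCY (verbatim): «continuum YM on T⁴ ⇐ BetaPertH ∧ nine spine estimates (0/9 proved); BetaPertH ⇐ (D1) ∧ (D4) ∧ CAP+tail;
G-an2-4 gates asym, D1 and NE2/3/4.»

WHY.  By `ExchangeESectorStaircase.exchangeWord_sector_eq_stair` the E-sector EE word of (C) at level `j+1` is `c·Σ_{x,a} L_{μα}(a,x)·(X̃♮ R_{νβ})(a,x)` with the currents
`R_{νβ} = ½·E2_{j+1}(⌊·_ν∕Lc⌋χ_β ê_β)`, `L_{μα} = −½·E2_{j+1}ᵀ(⌊·_μ∕Lc⌋χ_α ê_α)`.  This file: `R_{νβ} = −R_{βν}`, `R_{νν} = 0` (and the same for `L`), so the word is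
`P(μα;νβ) + P(να;μβ)` with `P` antisymmetric in each index pair — road-P2 g47's `|A∧a|²` pattern tensor (R-2) by index algebra (at `d+1 = 2`: `EX(0011) = 2P(01;01)`, `EX(0101) = −P(01;01)`,
ratio `−2 : 1`, as the engine printed, E-leaf06-g53-1 kit j201825).  Mechanism: `d(⌊·_ν∕Lc⌋·⌊·_β∕Lc⌋)_l = [l = β]·⌊·_ν∕Lc⌋·χ_β + [l = ν]·χ_ν·⌊·_β∕Lc⌋` exactly (the two factors move along
different axes), and `E2_{j+1}` kills gradients of potentials of QUADRATIC growth (§1–§2: D1's «exponential decay beats linear growth» one power up).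
* §1 `summable_decay_mul_of_quadGrowth` (`|K z| ≤ C·e^{−δ|c−z|₁}`, `|φ z| ≤ A + B·|z|₁²` ⟹ `z ↦ K z·φ z` summable), `summable_wΦ_shift_mul_of_quadGrowth`, `summable_wΦ_row_mul_of_quadGrowth`,
  `quadGrowth_shift` (the class is shift-stable).
* §2 **`tsum_E2_mul_grad_eq_zero_of_quadGrowth`**, **`tsum_grad_mul_E2_eq_zero_of_quadGrowth`** — the value Hessian kills pure gauges of quadratic growth (column ∕ row form).
* §3 `stairProd_grad`, `abs_stairProd_le`; **`stairFace_antisymm`**, **`stairFace_diag_eq_zero`** (second-leg currents); **`stairFace_antisymm_fst`**, **`stairFace_diag_eq_zero_fst`** (first-leg).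
Asserts NO value of Bałaban's tables; discharges NOTHING of (C) ∕ (C)sym ∕ (Q-L) ∕ «T2Shape» ∕ «T2Drift» ∕ (hW, hWall); NEVER «G-an2-4 closed» as (CONV-C); NOT D1, NOT `BetaPertH`,
NOT continuum, NOT Clay.  2026-08-23; no existing file touched.
-/

noncomputable section

open Finset
open scoped BigOperators
open Literature.MathematicalPhysics.QuantumFieldTheory
open Literature.MathematicalPhysics.QuantumFieldTheory.Balaban1983to89
open Literature.MathematicalPhysics.QuantumFieldTheory.Balaban1983to89.Beta
open B12Sec2to5 (l1 l1_nonneg abs_coord_le_l1)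
open ExpKernelCalculus (Site MKer summable_exp_shift l1_sub_triangle l1_sub_symm)
open AffineAveraging (unitVec)
open KernelSpecInstance (wΦ decay_wΦ)
open OneStepResolventKernel (Fib)
open BalabanStepJetsSucc (E2)
open Summit.QuantumFields.BalabanUV.Beta.AxialDressingRooted (one_le_of_neZero)
open Summit.QuantumFields.BalabanUV.Beta.BorderedHessian (E2_inl_inl_eq_wΦ)
open Summit.QuantumFields.BalabanUV.Beta.GAN24.ValueHessianLinearGauge (le_two_div_mul_exp tsum_wΦ_mul_grad_eq_zero_of_summable tsum_grad_mul_wΦ_eq_zero_of_summable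
  staircase_grad abs_staircase_le tsum_E2_mul_exitFace_eq_zero' tsum_exitFace_mul_E2_eq_zero')
open Summit.QuantumFields.BalabanUV.Beta.GAN24.ExitFaceHalfVertexSplit (summable_E2_mul_linGrowth_face summable_linGrowth_face_mul_E2)
open Summit.QuantumFields.BalabanUV.Beta.GAN24.ExitFaceSlotStaircase (abs_stair_le)

namespace Summit.QuantumFields.BalabanUV.Beta.GAN24.StaircaseCurrentAntisymm

variable {d : ℕ}

/-! ## §1 Exponential decay beats quadratic growth -/

/-- [folklore] `t² ≤ (16∕δ²)·e^{(δ∕2)·t}` for `t ≥ 0`, `δ > 0` (`t ≤ (4∕δ)e^{(δ∕4)t}` squared). -/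
theorem sq_le_mul_exp {δ t : ℝ} (hδ : 0 < δ) (ht : 0 ≤ t) : t ^ 2 ≤ (16 / δ ^ 2) * Real.exp ((δ / 2) * t) := by
  have h := le_two_div_mul_exp (half_pos hδ) ht
  have h4 : (2 / (δ / 2) : ℝ) = 4 / δ := by field_simp; ring
  rw [h4] at h
  have h0 : 0 ≤ (4 / δ) * Real.exp ((δ / 2 / 2) * t) := by positivity
  calc t ^ 2 ≤ ((4 / δ) * Real.exp ((δ / 2 / 2) * t)) ^ 2 := pow_le_pow_left₀ ht h 2
    _ = (16 / δ ^ 2) * (Real.exp ((δ / 2 / 2) * t) * Real.exp ((δ / 2 / 2) * t)) := by ring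
    _ = (16 / δ ^ 2) * Real.exp ((δ / 2) * t) := by rw [← Real.exp_add]; congr 2; ring

/-- [folklore] **EXPONENTIAL DECAY ABOUT A CENTRE BEATS QUADRATIC GROWTH**: `|K z| ≤ C·e^{−δ|c−z|₁}` and `|φ z| ≤ A + B·|z|₁²` ⟹ `z ↦ K z·φ z` summable
(majorant `C(|A| + 2|B||c|₁²)e^{−δ|c−z|₁} + 2C|B|(16∕δ²)e^{−(δ∕2)|c−z|₁}`, using `|z|₁² ≤ 2|c|₁² + 2|c−z|₁²` and `t²e^{−δt} ≤ (16∕δ²)e^{−δt∕2}`). -/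
theorem summable_decay_mul_of_quadGrowth {K φ : Site (d + 1) → ℝ} {C δ A B : ℝ} (hδ : 0 < δ) (c : Site (d + 1))
    (hK : ∀ z, |K z| ≤ C * Real.exp (-δ * l1 (c - z))) (hφ : ∀ z, |φ z| ≤ A + B * l1 z ^ 2) : Summable fun z => K z * φ z := by
  have hC : 0 ≤ C := by
    have h := hK c
    have hexp : 0 < Real.exp (-δ * l1 (c - c)) := Real.exp_pos _
    nlinarith [abs_nonneg (K c)]
  have hB' : (0 : ℝ) ≤ |B| := abs_nonneg B
  have hmaj : Summable fun z : Site (d + 1) =>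
      C * (|A| + 2 * |B| * l1 c ^ 2) * Real.exp (-δ * l1 (c - z)) + 2 * C * |B| * (16 / δ ^ 2) * Real.exp (-(δ / 2) * l1 (c - z)) :=
    (((summable_exp_shift hδ c).mul_left _).add ((summable_exp_shift (half_pos hδ) c).mul_left _))
  refine Summable.of_norm_bounded hmaj fun z => ?_
  rw [Real.norm_eq_abs, abs_mul]
  have hl : l1 z ≤ l1 c + l1 (c - z) := by
    have h := l1_sub_triangle z c 0
    simp only [sub_zero] at h
    rw [l1_sub_symm z c] at h
    linarith
  have hl2 : l1 z ^ 2 ≤ 2 * l1 c ^ 2 + 2 * l1 (c - z) ^ 2 := by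
    have h1 : l1 z ^ 2 ≤ (l1 c + l1 (c - z)) ^ 2 := pow_le_pow_left₀ (l1_nonneg z) hl 2
    nlinarith [sq_nonneg (l1 c - l1 (c - z))]
  have hgrow : |φ z| ≤ (|A| + 2 * |B| * l1 c ^ 2) + 2 * |B| * l1 (c - z) ^ 2 := by
    calc |φ z| ≤ |A| + |B| * l1 z ^ 2 := (hφ z).trans (add_le_add (le_abs_self A) (mul_le_mul_of_nonneg_right (le_abs_self B) (by positivity)))
      _ ≤ |A| + |B| * (2 * l1 c ^ 2 + 2 * l1 (c - z) ^ 2) := by gcongr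
      _ = _ := by ring
  have hexp2 : l1 (c - z) ^ 2 * Real.exp (-δ * l1 (c - z)) ≤ (16 / δ ^ 2) * Real.exp (-(δ / 2) * l1 (c - z)) := by
    have h := sq_le_mul_exp hδ (l1_nonneg (c - z))
    calc l1 (c - z) ^ 2 * Real.exp (-δ * l1 (c - z)) ≤ ((16 / δ ^ 2) * Real.exp ((δ / 2) * l1 (c - z))) * Real.exp (-δ * l1 (c - z)) :=
          mul_le_mul_of_nonneg_right h (Real.exp_pos _).le
      _ = (16 / δ ^ 2) * Real.exp (-(δ / 2) * l1 (c - z)) := by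
          rw [mul_assoc, ← Real.exp_add]; congr 2; ring
  have hA0 : 0 ≤ |A| + 2 * |B| * l1 c ^ 2 := by positivity
  calc |K z| * |φ z|
      ≤ (C * Real.exp (-δ * l1 (c - z))) * ((|A| + 2 * |B| * l1 c ^ 2) + 2 * |B| * l1 (c - z) ^ 2) := mul_le_mul (hK z) hgrow (abs_nonneg _) (by positivity)
    _ = C * (|A| + 2 * |B| * l1 c ^ 2) * Real.exp (-δ * l1 (c - z)) + 2 * C * |B| * (l1 (c - z) ^ 2 * Real.exp (-δ * l1 (c - z))) := by ring
    _ ≤ C * (|A| + 2 * |B| * l1 c ^ 2) * Real.exp (-δ * l1 (c - z)) + 2 * C * |B| * ((16 / δ ^ 2) * Real.exp (-(δ / 2) * l1 (c - z))) := by gcongr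
    _ = _ := by ring

/-- [folklore] The quadratic-growth class is shift-stable: `|φ z| ≤ A + B·|z|₁²` ⟹ `|φ (z + v)| ≤ (|A| + 2|B||v|₁²) + 2|B|·|z|₁²`. -/
theorem quadGrowth_shift {φ : Site (d + 1) → ℝ} {A B : ℝ} (hφ : ∀ z, |φ z| ≤ A + B * l1 z ^ 2) (v : Site (d + 1)) :
    ∀ z, |φ (z + v)| ≤ (|A| + 2 * |B| * l1 v ^ 2) + (2 * |B|) * l1 z ^ 2 := by
  intro z
  have h := hφ (z + v)
  have ht : l1 (z + v) ≤ l1 z + l1 v := by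
    have h3 := l1_sub_triangle (z + v) z 0
    simp only [sub_zero, add_sub_cancel_left] at h3
    linarith [l1_sub_symm (z + v) z]
  have ht2 : l1 (z + v) ^ 2 ≤ 2 * l1 z ^ 2 + 2 * l1 v ^ 2 := by
    have h1 : l1 (z + v) ^ 2 ≤ (l1 z + l1 v) ^ 2 := pow_le_pow_left₀ (l1_nonneg (z + v)) ht 2
    nlinarith [sq_nonneg (l1 z - l1 v)]
  have hBl : B * l1 (z + v) ^ 2 ≤ |B| * (2 * l1 z ^ 2 + 2 * l1 v ^ 2) :=
    (le_abs_self _).trans (by rw [abs_mul, abs_of_nonneg (by positivity : (0 : ℝ) ≤ l1 (z + v) ^ 2)]; gcongr)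
  have hA : A ≤ |A| := le_abs_self A
  nlinarith

section WΦ

variable {N : ℕ} [NeZero N]

/-- [folklore] The shifted multiplier-response kernel times a potential of quadratic growth is summable (column form): `y ↦ wΦ κ l (x − y + v)·φ y`. -/
theorem summable_wΦ_shift_mul_of_quadGrowth {φ : Site (d + 1) → ℝ} {A B : ℝ} (hφ : ∀ y, |φ y| ≤ A + B * l1 y ^ 2) (κ l : Fin (d + 1))
    (x v : Site (d + 1)) : Summable fun y => wΦ (N := N) κ l (x - y + v) * φ y := by
  obtain ⟨δ, C, hδ, hdec⟩ := decay_wΦ (N := N) (d := d)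
  refine summable_decay_mul_of_quadGrowth (C := C) hδ (x + v) (fun y => ?_) hφ
  have e : x - y + v = x + v - y := by abel
  rw [e]
  exact hdec κ l (x + v - y)

/-- [folklore] … (row form): `x ↦ wΦ κ l (x − w − y)·φ x`. -/
theorem summable_wΦ_row_mul_of_quadGrowth {φ : Site (d + 1) → ℝ} {A B : ℝ} (hφ : ∀ y, |φ y| ≤ A + B * l1 y ^ 2) (κ l : Fin (d + 1))
    (y w : Site (d + 1)) : Summable fun x => wΦ (N := N) κ l (x - w - y) * φ x := by
  obtain ⟨δ, C, hδ, hdec⟩ := decay_wΦ (N := N) (d := d)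
  refine summable_decay_mul_of_quadGrowth (C := C) hδ (w + y) (fun x => ?_) hφ
  have e : x - w - y = x - (w + y) := by abel
  rw [e, l1_sub_symm (w + y) x]
  exact hdec κ l (x - (w + y))

/-- [folklore] **`wΦ` KILLS PURE GAUGES OF QUADRATIC GROWTH (column form)**. -/
theorem tsum_wΦ_mul_grad_eq_zero_of_quadGrowth (κ : Fin (d + 1)) (x : Site (d + 1)) {φ : Site (d + 1) → ℝ} {A B : ℝ}
    (hφ : ∀ y, |φ y| ≤ A + B * l1 y ^ 2) : ∑' y, ∑ l, wΦ (N := N) κ l (x - y) * (φ (y + unitVec l) - φ y) = 0 := by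
  refine tsum_wΦ_mul_grad_eq_zero_of_summable κ x (fun l => ?_) (fun l => ?_) (fun l => ?_)
  · have h := summable_wΦ_shift_mul_of_quadGrowth (N := N) (quadGrowth_shift hφ (unitVec l)) κ l x 0
    simpa using h
  · have h := summable_wΦ_shift_mul_of_quadGrowth (N := N) hφ κ l x 0
    simpa using h
  · exact summable_wΦ_shift_mul_of_quadGrowth (N := N) hφ κ l x (unitVec l)

/-- [folklore] **`wΦ` KILLS PURE GAUGES OF QUADRATIC GROWTH (row form)**. -/
theorem tsum_grad_mul_wΦ_eq_zero_of_quadGrowth (l : Fin (d + 1)) (y : Site (d + 1)) {φ : Site (d + 1) → ℝ} {A B : ℝ}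
    (hφ : ∀ x, |φ x| ≤ A + B * l1 x ^ 2) : ∑' x, ∑ κ, (φ (x + unitVec κ) - φ x) * wΦ (N := N) κ l (x - y) = 0 := by
  refine tsum_grad_mul_wΦ_eq_zero_of_summable l y (fun κ => ?_) (fun κ => ?_) (fun κ => ?_)
  · have h := summable_wΦ_row_mul_of_quadGrowth (N := N) (quadGrowth_shift hφ (unitVec κ)) κ l y 0
    simpa using h
  · have h := summable_wΦ_row_mul_of_quadGrowth (N := N) hφ κ l y 0
    simpa using h
  · exact summable_wΦ_row_mul_of_quadGrowth (N := N) hφ κ l y (unitVec κ)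

end WΦ

/-! ## §2 The value Hessian kills pure gauges of quadratic growth -/

section ValueHessian

variable {Lc : ℕ} [NeZero Lc]

/-- [folklore] **THE VALUE HESSIAN KILLS PURE GAUGES OF QUADRATIC GROWTH (column form)**, every step `j`:
`Σ'_y Σ_l E2 d Lc j (x,y)_{inl κ, inl l}·(φ (y + e_l) − φ y) = 0` for `|φ y| ≤ A + B·|y|₁²`. -/
theorem tsum_E2_mul_grad_eq_zero_of_quadGrowth (j : ℕ) (κ : Fin (d + 1)) (x : Site (d + 1)) {φ : Site (d + 1) → ℝ} {A B : ℝ}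
    (hφ : ∀ y, |φ y| ≤ A + B * l1 y ^ 2) : ∑' y, ∑ l, E2 d Lc j x y (Sum.inl κ) (Sum.inl l) * (φ (y + unitVec l) - φ y) = 0 := by
  simp only [E2_inl_inl_eq_wΦ]
  exact tsum_wΦ_mul_grad_eq_zero_of_quadGrowth (N := Lc ^ j) κ x hφ

/-- [folklore] **… row form**: `Σ'_x Σ_κ (φ (x + e_κ) − φ x)·E2 d Lc j (x,y)_{inl κ, inl l} = 0`. -/
theorem tsum_grad_mul_E2_eq_zero_of_quadGrowth (j : ℕ) (l : Fin (d + 1)) (y : Site (d + 1)) {φ : Site (d + 1) → ℝ} {A B : ℝ}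
    (hφ : ∀ x, |φ x| ≤ A + B * l1 x ^ 2) : ∑' x, ∑ κ, (φ (x + unitVec κ) - φ x) * E2 d Lc j x y (Sum.inl κ) (Sum.inl l) = 0 := by
  simp only [E2_inl_inl_eq_wΦ]
  exact tsum_grad_mul_wΦ_eq_zero_of_quadGrowth (N := Lc ^ j) l y hφ

/-! ## §3 The product of two staircases and the antisymmetry of the staircase currents -/

omit [NeZero Lc] in
/-- [folklore] **THE GRADIENT OF THE PRODUCT OF TWO STAIRCASES** (`ν ≠ β`, `1 ≤ Lc`): `⌊(y+e_l)_ν∕Lc⌋⌊(y+e_l)_β∕Lc⌋ − ⌊y_ν∕Lc⌋⌊y_β∕Lc⌋ =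
[l = β]·⌊y_ν∕Lc⌋·χ_β(y) + [l = ν]·χ_ν(y)·⌊y_β∕Lc⌋` — the two factors move along different axes, so the lattice Leibniz rule has no cross term. -/
theorem stairProd_grad (hLc : 1 ≤ Lc) {ν β : Fin (d + 1)} (hνβ : ν ≠ β) (y : Site (d + 1)) (l : Fin (d + 1)) :
    ((((y + unitVec l) ν / (Lc : ℤ) : ℤ) : ℝ)) * ((((y + unitVec l) β / (Lc : ℤ) : ℤ) : ℝ)) - (((y ν / (Lc : ℤ) : ℤ) : ℝ)) * (((y β / (Lc : ℤ) : ℤ) : ℝ)) =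
      (if l = β then (((y ν / (Lc : ℤ) : ℤ) : ℝ)) * (if y β % (Lc : ℤ) = (Lc : ℤ) - 1 then 1 else 0) else 0)
        + (if l = ν then (if y ν % (Lc : ℤ) = (Lc : ℤ) - 1 then 1 else 0) * (((y β / (Lc : ℤ) : ℤ) : ℝ)) else 0) := by
  have hν := staircase_grad (d := d) hLc 1 ν y l
  have hβ := staircase_grad (d := d) hLc 1 β y l
  rw [one_mul, one_mul] at hν hβ
  -- write the shifted staircases as «old + increment»
  have eν : ((((y + unitVec l) ν / (Lc : ℤ) : ℤ) : ℝ)) = (((y ν / (Lc : ℤ) : ℤ) : ℝ)) + (if l = ν then (if y ν % (Lc : ℤ) = (Lc : ℤ) - 1 then 1 else 0) else 0) := by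
    linarith
  have eβ : ((((y + unitVec l) β / (Lc : ℤ) : ℤ) : ℝ)) = (((y β / (Lc : ℤ) : ℤ) : ℝ)) + (if l = β then (if y β % (Lc : ℤ) = (Lc : ℤ) - 1 then 1 else 0) else 0) := by
    linarith
  rw [eν, eβ]
  by_cases hlν : l = ν
  · subst hlν
    simp only [if_true, if_neg hνβ]
    ring
  · simp only [if_neg hlν]
    split_ifs <;> ring

omit [NeZero Lc] in
/-- [folklore] Quadratic growth of the product of two staircases: `|⌊y_ν∕Lc⌋⌊y_β∕Lc⌋| ≤ 0 + 1·|y|₁²`. -/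
theorem abs_stairProd_le (ν β : Fin (d + 1)) (y : Site (d + 1)) :
    |(((y ν / (Lc : ℤ) : ℤ) : ℝ)) * (((y β / (Lc : ℤ) : ℤ) : ℝ))| ≤ 0 + 1 * l1 y ^ 2 := by
  have h1 := abs_stair_le (d := d) (Lc := Lc) ν y
  have h2 := abs_stair_le (d := d) (Lc := Lc) β y
  rw [zero_add, one_mul] at h1 h2 ⊢
  rw [abs_mul, sq]
  exact mul_le_mul h1 h2 (abs_nonneg _) (l1_nonneg y)

/-- [folklore] **THE SECOND-LEG STAIRCASE CURRENT IS ANTISYMMETRIC IN (BACKGROUND DIRECTION, LEG DIRECTION)** (`ν ≠ β`; every `j`, open leg `(b, z)`):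
`Σ'_{s′} E2 d Lc (j+1) (z,s′)_{bβ}·(⌊s′_ν∕Lc⌋·χ_β(s′)) + Σ'_{s′} E2 d Lc (j+1) (z,s′)_{bν}·(⌊s′_β∕Lc⌋·χ_ν(s′)) = 0`. -/
theorem stairFace_antisymm (j : ℕ) {ν β : Fin (d + 1)} (hνβ : ν ≠ β) (z : Site (d + 1)) (b : Fin (d + 1)) :
    (∑' s' : Site (d + 1), E2 d Lc (j + 1) z s' (Sum.inl b) (Sum.inl β) * ((((s' ν / (Lc : ℤ) : ℤ) : ℝ)) * (if s' β % (Lc : ℤ) = (Lc : ℤ) - 1 then (1 : ℝ) else 0)))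
      + (∑' s' : Site (d + 1), E2 d Lc (j + 1) z s' (Sum.inl b) (Sum.inl ν) * ((((s' β / (Lc : ℤ) : ℤ) : ℝ)) * (if s' ν % (Lc : ℤ) = (Lc : ℤ) - 1 then (1 : ℝ) else 0))) = 0 := by
  have hLc : 1 ≤ Lc := one_le_of_neZero Lc
  have key := tsum_E2_mul_grad_eq_zero_of_quadGrowth (Lc := Lc) (j + 1) b z
    (φ := fun y : Site (d + 1) => (((y ν / (Lc : ℤ) : ℤ) : ℝ)) * (((y β / (Lc : ℤ) : ℤ) : ℝ))) (abs_stairProd_le ν β)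
  have hpt : ∀ s' : Site (d + 1), (∑ l, E2 d Lc (j + 1) z s' (Sum.inl b) (Sum.inl l) *
      ((((( s' + unitVec l) ν / (Lc : ℤ) : ℤ) : ℝ)) * ((((s' + unitVec l) β / (Lc : ℤ) : ℤ) : ℝ)) - (((s' ν / (Lc : ℤ) : ℤ) : ℝ)) * (((s' β / (Lc : ℤ) : ℤ) : ℝ)))) =
      E2 d Lc (j + 1) z s' (Sum.inl b) (Sum.inl β) * ((((s' ν / (Lc : ℤ) : ℤ) : ℝ)) * (if s' β % (Lc : ℤ) = (Lc : ℤ) - 1 then (1 : ℝ) else 0))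
        + E2 d Lc (j + 1) z s' (Sum.inl b) (Sum.inl ν) * ((((s' β / (Lc : ℤ) : ℤ) : ℝ)) * (if s' ν % (Lc : ℤ) = (Lc : ℤ) - 1 then (1 : ℝ) else 0)) := by
    intro s'
    simp_rw [stairProd_grad hLc hνβ s', mul_add, Finset.sum_add_distrib]
    rw [Finset.sum_eq_single β (fun l _ hl => by rw [if_neg hl, mul_zero]) (fun h => absurd (Finset.mem_univ β) h),
      Finset.sum_eq_single ν (fun l _ hl => by rw [if_neg hl, mul_zero]) (fun h => absurd (Finset.mem_univ ν) h), if_pos rfl, if_pos rfl]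
    ring
  rw [tsum_congr hpt] at key
  have h1 := summable_E2_mul_linGrowth_face (d := d) (Lc := Lc) j (lam := fun s : Site (d + 1) => (((s ν / (Lc : ℤ) : ℤ) : ℝ))) (abs_stair_le ν) z b β
  have h2 := summable_E2_mul_linGrowth_face (d := d) (Lc := Lc) j (lam := fun s : Site (d + 1) => (((s β / (Lc : ℤ) : ℤ) : ℝ))) (abs_stair_le β) z b ν
  rwa [h1.tsum_add h2] at key

/-- [folklore] **THE DIAGONAL SECOND-LEG STAIRCASE CURRENT VANISHES**: `Σ'_{s′} E2 d Lc (j+1) (z,s′)_{bν}·(⌊s′_ν∕Lc⌋·χ_ν(s′)) = 0`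
(`d(⌊·_ν∕Lc⌋²)_l = [l = ν]·(2⌊·_ν∕Lc⌋χ_ν + χ_ν)` and the value Hessian kills both the gradient and the exit-face profile). -/
theorem stairFace_diag_eq_zero (j : ℕ) (ν : Fin (d + 1)) (z : Site (d + 1)) (b : Fin (d + 1)) :
    (∑' s' : Site (d + 1), E2 d Lc (j + 1) z s' (Sum.inl b) (Sum.inl ν) * ((((s' ν / (Lc : ℤ) : ℤ) : ℝ)) * (if s' ν % (Lc : ℤ) = (Lc : ℤ) - 1 then (1 : ℝ) else 0))) = 0 := by
  have hLc : 1 ≤ Lc := one_le_of_neZero Lc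
  have key := tsum_E2_mul_grad_eq_zero_of_quadGrowth (Lc := Lc) (j + 1) b z
    (φ := fun y : Site (d + 1) => (((y ν / (Lc : ℤ) : ℤ) : ℝ)) * (((y ν / (Lc : ℤ) : ℤ) : ℝ))) (abs_stairProd_le ν ν)
  have hpt : ∀ s' : Site (d + 1), (∑ l, E2 d Lc (j + 1) z s' (Sum.inl b) (Sum.inl l) *
      ((((( s' + unitVec l) ν / (Lc : ℤ) : ℤ) : ℝ)) * ((((s' + unitVec l) ν / (Lc : ℤ) : ℤ) : ℝ)) - (((s' ν / (Lc : ℤ) : ℤ) : ℝ)) * (((s' ν / (Lc : ℤ) : ℤ) : ℝ)))) =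
      2 * (E2 d Lc (j + 1) z s' (Sum.inl b) (Sum.inl ν) * ((((s' ν / (Lc : ℤ) : ℤ) : ℝ)) * (if s' ν % (Lc : ℤ) = (Lc : ℤ) - 1 then (1 : ℝ) else 0)))
        + E2 d Lc (j + 1) z s' (Sum.inl b) (Sum.inl ν) * (if s' ν % (Lc : ℤ) = (Lc : ℤ) - 1 then (1 : ℝ) else 0) := by
    intro s'
    have eν : ∀ l : Fin (d + 1), ((((s' + unitVec l) ν / (Lc : ℤ) : ℤ) : ℝ)) =
        (((s' ν / (Lc : ℤ) : ℤ) : ℝ)) + (if l = ν then (if s' ν % (Lc : ℤ) = (Lc : ℤ) - 1 then 1 else 0) else 0) := by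
      intro l
      have h := staircase_grad (d := d) hLc 1 ν s' l
      rw [one_mul, one_mul] at h
      linarith
    simp_rw [eν]
    rw [Finset.sum_eq_single ν (fun l _ hl => by rw [if_neg hl]; ring) (fun h => absurd (Finset.mem_univ ν) h), if_pos rfl]
    split_ifs <;> ring
  rw [tsum_congr hpt] at key
  have h1 := summable_E2_mul_linGrowth_face (d := d) (Lc := Lc) j (lam := fun s : Site (d + 1) => (((s ν / (Lc : ℤ) : ℤ) : ℝ))) (abs_stair_le ν) z b ν
  have h2 : Summable fun s' : Site (d + 1) => E2 d Lc (j + 1) z s' (Sum.inl b) (Sum.inl ν) * (if s' ν % (Lc : ℤ) = (Lc : ℤ) - 1 then (1 : ℝ) else 0) := by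
    have h := summable_E2_mul_linGrowth_face (d := d) (Lc := Lc) j (lam := fun _ : Site (d + 1) => (1 : ℝ)) (A := 1) (B := 0)
      (fun _ => by rw [zero_mul, add_zero, abs_one]) z b ν
    exact h.congr fun s' => by rw [one_mul]
  rw [(h1.mul_left 2).tsum_add h2, tsum_mul_left, tsum_E2_mul_exitFace_eq_zero' (Lc := Lc) (j + 1) hLc b ν z 1] at key
  linarith

/-- [folklore] **THE FIRST-LEG STAIRCASE CURRENT IS ANTISYMMETRIC IN (BACKGROUND DIRECTION, LEG DIRECTION)** (`μ ≠ α`; open leg `(a, x)`):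
`Σ'_y (⌊y_μ∕Lc⌋·χ_α(y))·E2 d Lc (j+1) (y,x)_{αa} + Σ'_y (⌊y_α∕Lc⌋·χ_μ(y))·E2 d Lc (j+1) (y,x)_{μa} = 0`. -/
theorem stairFace_antisymm_fst (j : ℕ) {μ α : Fin (d + 1)} (hμα : μ ≠ α) (x : Site (d + 1)) (a : Fin (d + 1)) :
    (∑' y : Site (d + 1), ((((y μ / (Lc : ℤ) : ℤ) : ℝ)) * (if y α % (Lc : ℤ) = (Lc : ℤ) - 1 then (1 : ℝ) else 0)) * E2 d Lc (j + 1) y x (Sum.inl α) (Sum.inl a))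
      + (∑' y : Site (d + 1), ((((y α / (Lc : ℤ) : ℤ) : ℝ)) * (if y μ % (Lc : ℤ) = (Lc : ℤ) - 1 then (1 : ℝ) else 0)) * E2 d Lc (j + 1) y x (Sum.inl μ) (Sum.inl a)) = 0 := by
  have hLc : 1 ≤ Lc := one_le_of_neZero Lc
  have key := tsum_grad_mul_E2_eq_zero_of_quadGrowth (Lc := Lc) (j + 1) a x
    (φ := fun y : Site (d + 1) => (((y μ / (Lc : ℤ) : ℤ) : ℝ)) * (((y α / (Lc : ℤ) : ℤ) : ℝ))) (abs_stairProd_le μ α)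
  have hpt : ∀ y : Site (d + 1), (∑ κ, ((((( y + unitVec κ) μ / (Lc : ℤ) : ℤ) : ℝ)) * ((((y + unitVec κ) α / (Lc : ℤ) : ℤ) : ℝ))
      - (((y μ / (Lc : ℤ) : ℤ) : ℝ)) * (((y α / (Lc : ℤ) : ℤ) : ℝ))) * E2 d Lc (j + 1) y x (Sum.inl κ) (Sum.inl a)) =
      ((((y μ / (Lc : ℤ) : ℤ) : ℝ)) * (if y α % (Lc : ℤ) = (Lc : ℤ) - 1 then (1 : ℝ) else 0)) * E2 d Lc (j + 1) y x (Sum.inl α) (Sum.inl a)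
        + ((((y α / (Lc : ℤ) : ℤ) : ℝ)) * (if y μ % (Lc : ℤ) = (Lc : ℤ) - 1 then (1 : ℝ) else 0)) * E2 d Lc (j + 1) y x (Sum.inl μ) (Sum.inl a) := by
    intro y
    simp_rw [stairProd_grad hLc hμα y, add_mul, Finset.sum_add_distrib]
    rw [Finset.sum_eq_single α (fun l _ hl => by rw [if_neg hl, zero_mul]) (fun h => absurd (Finset.mem_univ α) h),
      Finset.sum_eq_single μ (fun l _ hl => by rw [if_neg hl, zero_mul]) (fun h => absurd (Finset.mem_univ μ) h), if_pos rfl, if_pos rfl]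
    ring
  rw [tsum_congr hpt] at key
  have h1 := summable_linGrowth_face_mul_E2 (d := d) (Lc := Lc) j (lam := fun y : Site (d + 1) => (((y μ / (Lc : ℤ) : ℤ) : ℝ))) (abs_stair_le μ) x α a
  have h2 := summable_linGrowth_face_mul_E2 (d := d) (Lc := Lc) j (lam := fun y : Site (d + 1) => (((y α / (Lc : ℤ) : ℤ) : ℝ))) (abs_stair_le α) x μ a
  rwa [h1.tsum_add h2] at key

/-- [folklore] **THE DIAGONAL FIRST-LEG STAIRCASE CURRENT VANISHES**: `Σ'_y (⌊y_μ∕Lc⌋·χ_μ(y))·E2 d Lc (j+1) (y,x)_{μa} = 0`. -/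
theorem stairFace_diag_eq_zero_fst (j : ℕ) (μ : Fin (d + 1)) (x : Site (d + 1)) (a : Fin (d + 1)) :
    (∑' y : Site (d + 1), ((((y μ / (Lc : ℤ) : ℤ) : ℝ)) * (if y μ % (Lc : ℤ) = (Lc : ℤ) - 1 then (1 : ℝ) else 0)) * E2 d Lc (j + 1) y x (Sum.inl μ) (Sum.inl a)) = 0 := by
  have hLc : 1 ≤ Lc := one_le_of_neZero Lc
  have key := tsum_grad_mul_E2_eq_zero_of_quadGrowth (Lc := Lc) (j + 1) a x
    (φ := fun y : Site (d + 1) => (((y μ / (Lc : ℤ) : ℤ) : ℝ)) * (((y μ / (Lc : ℤ) : ℤ) : ℝ))) (abs_stairProd_le μ μ)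
  have hpt : ∀ y : Site (d + 1), (∑ κ, ((((( y + unitVec κ) μ / (Lc : ℤ) : ℤ) : ℝ)) * ((((y + unitVec κ) μ / (Lc : ℤ) : ℤ) : ℝ))
      - (((y μ / (Lc : ℤ) : ℤ) : ℝ)) * (((y μ / (Lc : ℤ) : ℤ) : ℝ))) * E2 d Lc (j + 1) y x (Sum.inl κ) (Sum.inl a)) =
      2 * (((((y μ / (Lc : ℤ) : ℤ) : ℝ)) * (if y μ % (Lc : ℤ) = (Lc : ℤ) - 1 then (1 : ℝ) else 0)) * E2 d Lc (j + 1) y x (Sum.inl μ) (Sum.inl a))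
        + (if y μ % (Lc : ℤ) = (Lc : ℤ) - 1 then (1 : ℝ) else 0) * E2 d Lc (j + 1) y x (Sum.inl μ) (Sum.inl a) := by
    intro y
    have eμ : ∀ κ : Fin (d + 1), ((((y + unitVec κ) μ / (Lc : ℤ) : ℤ) : ℝ)) =
        (((y μ / (Lc : ℤ) : ℤ) : ℝ)) + (if κ = μ then (if y μ % (Lc : ℤ) = (Lc : ℤ) - 1 then 1 else 0) else 0) := by
      intro κ
      have h := staircase_grad (d := d) hLc 1 μ y κ
      rw [one_mul, one_mul] at h
      linarith
    simp_rw [eμ]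
    rw [Finset.sum_eq_single μ (fun l _ hl => by rw [if_neg hl]; ring) (fun h => absurd (Finset.mem_univ μ) h), if_pos rfl]
    split_ifs <;> ring
  rw [tsum_congr hpt] at key
  have h1 := summable_linGrowth_face_mul_E2 (d := d) (Lc := Lc) j (lam := fun y : Site (d + 1) => (((y μ / (Lc : ℤ) : ℤ) : ℝ))) (abs_stair_le μ) x μ a
  have h2 : Summable fun y : Site (d + 1) => (if y μ % (Lc : ℤ) = (Lc : ℤ) - 1 then (1 : ℝ) else 0) * E2 d Lc (j + 1) y x (Sum.inl μ) (Sum.inl a) := by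
    have h := summable_linGrowth_face_mul_E2 (d := d) (Lc := Lc) j (lam := fun _ : Site (d + 1) => (1 : ℝ)) (A := 1) (B := 0)
      (fun _ => by rw [zero_mul, add_zero, abs_one]) x μ a
    exact h.congr fun y => by rw [one_mul]
  rw [(h1.mul_left 2).tsum_add h2, tsum_mul_left, tsum_exitFace_mul_E2_eq_zero' (Lc := Lc) (j + 1) hLc a μ x 1] at key
  linarith

end ValueHessian

end Summit.QuantumFields.BalabanUV.Beta.GAN24.StaircaseCurrentAntisymm

end
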